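import Literature.MathematicalPhysics.StatisticalMechanics.ComplexSpinSchwingerDyson
import HarnessLib

/-!
# Lemma 4.7 of Salmhofer–Seiler with perturbed rates (the real-variable induction (4.35)–(4.37))

HONEST FRAMING (cell `pub-ymgap`, seat qcd-lit g19, `bears_on: Q1`).  Pure real-variable algebra; no
lattice, no measure.  Salmhofer–Seiler's Lemma 4.7 [SalmhoferSeiler1991, (4.28)–(4.37)] deduces
`S_n ≤ α_n S_1` from the Schwinger–Dyson inequalities (4.35)
`S_{a} ≤ (1 - (a-1)/N) S_{a-1} - ∑_{b ≥ 2} b w_b S_{a-1+b}` by the induction (4.36)–(4.37); the proof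
uses of the rates `1 - j/N` only that they are NONNEGATIVE.  This file records the same induction with
an arbitrary nonnegative rate sequence `λ_j` in place of `1 - j/N` (the tree's `le_sdAlpha_mul_of_sd` is
the case `λ_j = 1 - j/N`, `sdAlphaP_rate`/`sdKP_rate`): this is the form in which the lemma survives a
small plaquette coupling `β > 0`, where the one-link gauge integrals reproduce (4.35) only up to factors
`1 + O(β)` (the cell's small-`β` programme, files `StaggeredSchwingerDysonFixedGauge`,
`GaugeLinkResampling`).  Also recorded: `α_n(λ)`, `K(λ) = ∑ k w_k α_k(λ)` depend continuously on the
rates (`tendsto_sdAlphaP`, `tendsto_sdKP`), so that `K(λ(β)) → K(N)` as `β → 0`.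

References: M. Salmhofer, E. Seiler, CMP 139 (1991) 395, Lemma 4.7, (4.28)–(4.39) [SalmhoferSeiler1991].
-/

noncomputable section

open Finset Filter Topology

namespace Literature.MathematicalPhysics.StatisticalMechanics

namespace ComplexSpin

/-- `P_n(k) = ∏_{l=1}^{k} λ_{n-l}` — (4.36) with rates `λ_j` for `1 - j/N` (`l = i+1`). [cite: SalmhoferSeiler1991, (4.36)] -/
def sdProdP (lam : ℕ → ℝ) (n k : ℕ) : ℝ :=
  ∏ i ∈ range k, lam (n - 1 - i)

/-- **`α_n(λ) = ∏_{p=1}^{n-1} λ_p / (1 + ∑_{k=2}^{n-1} k w_k ∏_{l=1}^{k-1} λ_{n-l})`** — (4.29) (product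
form, see the ERRATUM in `ComplexSpinSchwingerDyson`) with rates `λ_j` for `1 - j/N`. [cite: SalmhoferSeiler1991, (4.29)] -/
def sdAlphaP (lam : ℕ → ℝ) (w : ℕ → ℝ) (n : ℕ) : ℝ :=
  (∏ i ∈ range (n - 1), lam (i + 1)) /
    (1 + ∑ i ∈ range (n - 2), ((i + 2 : ℕ) : ℝ) * w (i + 2) * sdProdP lam n (i + 1))

/-- **`K(λ) = ∑_{k=1}^{N} k w_k α_k(λ)`** — (4.39) with rates `λ_j` for `1 - j/N`. [cite: SalmhoferSeiler1991, (4.39)] -/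
def sdKP (N : ℕ) (lam w : ℕ → ℝ) : ℝ :=
  ∑ k ∈ range (N + 1), (k : ℝ) * w k * sdAlphaP lam w k

/-- The printed rates `λ_j = 1 - j/N`. [cite: SalmhoferSeiler1991, (4.35)] -/
def sdRate (N : ℕ) (j : ℕ) : ℝ := 1 - (j : ℝ) / N

/-- At the printed rates `P_n(k)` is the tree's `sdProd`. [cite: SalmhoferSeiler1991, (4.36)] -/
theorem sdProdP_rate (N n k : ℕ) : sdProdP (sdRate N) n k = sdProd N n k := rfl

/-- At the printed rates `α_n(λ)` is the tree's `sdAlpha`. [cite: SalmhoferSeiler1991, (4.29)] -/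
theorem sdAlphaP_rate (N : ℕ) (w : ℕ → ℝ) (n : ℕ) : sdAlphaP (sdRate N) w n = sdAlpha N w n := rfl

/-- At the printed rates `K(λ)` is the tree's `sdK`. [cite: SalmhoferSeiler1991, (4.39)] -/
theorem sdKP_rate (N : ℕ) (w : ℕ → ℝ) : sdKP N (sdRate N) w = sdK N w := rfl

/-- `α₁(λ) = 1`. [cite: SalmhoferSeiler1991, (4.39)] -/
theorem sdAlphaP_one (lam w : ℕ → ℝ) : sdAlphaP lam w 1 = 1 := by
  simp [sdAlphaP]

/-- `P_n(k) ≥ 0` for rates nonnegative up to `N`, `n ≤ N`. [cite: SalmhoferSeiler1991, (4.36)] -/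
theorem sdProdP_nonneg {N : ℕ} {lam : ℕ → ℝ} (hlam : ∀ j, j ≤ N → 0 ≤ lam j) {n : ℕ} (hn : n ≤ N) (k : ℕ) :
    0 ≤ sdProdP lam n k :=
  Finset.prod_nonneg fun i _ => hlam _ (by omega)

/-- The denominator of `α_n(λ)` is `≥ 1` for nonnegative rates and `w_k ≥ 0` (`2 ≤ k ≤ N`), `n ≤ N`. [cite: SalmhoferSeiler1991, (4.29)] -/
theorem one_le_sdAlphaP_den {N : ℕ} {lam w : ℕ → ℝ} (hlam : ∀ j, j ≤ N → 0 ≤ lam j) (hw : ∀ k, 2 ≤ k → k ≤ N → 0 ≤ w k)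
    {n : ℕ} (hnN : n ≤ N) :
    1 ≤ 1 + ∑ i ∈ range (n - 2), ((i + 2 : ℕ) : ℝ) * w (i + 2) * sdProdP lam n (i + 1) := by
  have : 0 ≤ ∑ i ∈ range (n - 2), ((i + 2 : ℕ) : ℝ) * w (i + 2) * sdProdP lam n (i + 1) := by
    refine Finset.sum_nonneg fun i hi => ?_
    have hi' := Finset.mem_range.mp hi
    exact mul_nonneg (mul_nonneg (Nat.cast_nonneg _) (hw (i + 2) (by omega) (by omega))) (sdProdP_nonneg hlam hnN _)
  linarith

/-- `α_n(λ) ≥ 0` for nonnegative rates and `w_k ≥ 0`, `n ≤ N`. [cite: SalmhoferSeiler1991, (4.29)] -/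
theorem sdAlphaP_nonneg {N : ℕ} {lam w : ℕ → ℝ} (hlam : ∀ j, j ≤ N → 0 ≤ lam j) (hw : ∀ k, 2 ≤ k → k ≤ N → 0 ≤ w k)
    {n : ℕ} (hnN : n ≤ N) : 0 ≤ sdAlphaP lam w n :=
  div_nonneg (Finset.prod_nonneg fun i hi => hlam _ (by have := Finset.mem_range.mp hi; omega))
    (zero_le_one.trans (one_le_sdAlphaP_den hlam hw hnN))

/-- `K(λ) ≥ 0` for nonnegative rates and `w_k ≥ 0` (`1 ≤ k ≤ N`). [cite: SalmhoferSeiler1991, (4.39)] -/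
theorem sdKP_nonneg {N : ℕ} {lam w : ℕ → ℝ} (hlam : ∀ j, j ≤ N → 0 ≤ lam j) (hw1 : 0 ≤ w 1) (hw : ∀ k, 2 ≤ k → k ≤ N → 0 ≤ w k) :
    0 ≤ sdKP N lam w := by
  refine Finset.sum_nonneg fun k hk => ?_
  have hkN : k ≤ N := Nat.lt_succ_iff.mp (Finset.mem_range.mp hk)
  rcases Nat.eq_zero_or_pos k with rfl | hk1
  · simp
  have hwk : 0 ≤ w k := by
    rcases Nat.lt_or_ge k 2 with h | h
    · rw [show k = 1 by omega]; exact hw1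
    · exact hw k h hkN
  exact mul_nonneg (mul_nonneg (Nat.cast_nonneg k) hwk) (sdAlphaP_nonneg hlam hw hkN)

/-- **Lemma 4.7 with perturbed rates (real-variable core).**  Let `N ≥ 1`, `w₁ = 1`, `w_k ≥ 0`
(`2 ≤ k ≤ N`), rates `λ_j ≥ 0` (`j ≤ N`), and `S : ℕ → ℝ` nonnegative with the Schwinger–Dyson inequalities
`∑_{u ≤ N} u w_u S_{j+u} ≤ λ_j S_j` for all `j` ((4.35) with `λ_j` for `1 - j/N`).  Then
`S_n ≤ α_n(λ) S_1` for `1 ≤ n ≤ N`, by the induction (4.36)–(4.37) verbatim. [cite: SalmhoferSeiler1991, Lemma 4.7 ((4.35)–(4.37))] -/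
theorem le_sdAlphaP_mul_of_sd {N : ℕ} (hN : 1 ≤ N) {w : ℕ → ℝ} (hw1 : w 1 = 1)
    (hw : ∀ k, 2 ≤ k → k ≤ N → 0 ≤ w k) {lam : ℕ → ℝ} (hlam : ∀ j, j ≤ N → 0 ≤ lam j) {S : ℕ → ℝ} (hS0 : ∀ n, 0 ≤ S n)
    (hsd : ∀ j : ℕ, ∑ u ∈ range (N + 1), (u : ℝ) * w u * S (j + u) ≤ lam j * S j)
    {n : ℕ} (hn1 : 1 ≤ n) (hnN : n ≤ N) : S n ≤ sdAlphaP lam w n * S 1 := by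
  have hw' : ∀ k, 1 ≤ k → k ≤ N → 0 ≤ w k := by
    intro k hk1 hkN
    rcases Nat.lt_or_ge k 2 with hk | hk
    · rw [show k = 1 by omega, hw1]; exact zero_le_one
    · exact hw k hk hkN
  -- the terms of the SD sum are nonnegative
  have hterm : ∀ j u, u ∈ range (N + 1) → 0 ≤ (u : ℝ) * w u * S (j + u) := by
    intro j u hu
    have huN : u ≤ N := Nat.lt_succ_iff.mp (Finset.mem_range.mp hu)
    rcases Nat.eq_zero_or_pos u with rfl | hu1
    · simp
    · exact mul_nonneg (mul_nonneg (Nat.cast_nonneg u) (hw' u hu1 huN)) (hS0 _)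
  -- (4.35) with only the `u = 1` term kept: `S_{j+1} ≤ λ_j S_j`
  have hstep1 : ∀ j : ℕ, S (j + 1) ≤ lam j * S j := by
    intro j
    have h1 : (1 : ℕ) ∈ range (N + 1) := Finset.mem_range.mpr (by omega)
    have := Finset.single_le_sum (fun u hu => hterm j u hu) h1
    simp only [Nat.cast_one, one_mul, hw1] at this
    exact this.trans (hsd j)
  -- (4.35) with the `u = 1` and `u = k` terms kept
  have hstep2 : ∀ j k : ℕ, 2 ≤ k → k ≤ N →
      S (j + 1) + (k : ℝ) * w k * S (j + k) ≤ lam j * S j := by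
    intro j k hk2 hkN
    have hsub : ({1, k} : Finset ℕ) ⊆ range (N + 1) := by
      intro u hu
      rw [Finset.mem_insert, Finset.mem_singleton] at hu
      rw [Finset.mem_range]; omega
    have := Finset.sum_le_sum_of_subset_of_nonneg hsub (fun u hu _ => hterm j u hu)
    rw [Finset.sum_pair (by omega : (1 : ℕ) ≠ k)] at this
    simp only [Nat.cast_one, one_mul, hw1] at this
    exact this.trans (hsd j)
  -- the case `n = 1`
  rcases Nat.lt_or_ge n 2 with hn | hn2
  · rw [show n = 1 by omega, sdAlphaP_one, one_mul]
  -- (4.36) by induction on `k' = k - 1`: `S_n (1 + ∑_{i<k'} …) ≤ P(k'+1) S_{n-k'-1}` for `k' ≤ n-2`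
  have hind : ∀ k' : ℕ, k' ≤ n - 2 →
      S n * (1 + ∑ i ∈ range k', ((i + 2 : ℕ) : ℝ) * w (i + 2) * sdProdP lam n (i + 1)) ≤
        sdProdP lam n (k' + 1) * S (n - k' - 1) := by
    intro k'
    induction k' with
    | zero =>
      intro _
      rw [Finset.sum_range_zero, add_zero, mul_one, sdProdP, Finset.prod_range_one]
      have := hstep1 (n - 0 - 1)
      rw [show n - 0 - 1 + 1 = n by omega] at this
      simpa using this
    | succ k' ih =>
      intro hk'
      have ih' := ih (by omega)
      set j := n - k' - 2 with hj
      have hj1 : j + 1 = n - k' - 1 := by omega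
      have hj2 : j + (k' + 2) = n := by omega
      have h35 := hstep2 j (k' + 2) (by omega) (by omega)
      rw [hj1, hj2] at h35
      -- multiply (4.37) by `P(k'+1) ≥ 0`
      have hP : 0 ≤ sdProdP lam n (k' + 1) := sdProdP_nonneg hlam hnN _
      have h37 := mul_le_mul_of_nonneg_left h35 hP
      have hPsucc : sdProdP lam n (k' + 1 + 1) = sdProdP lam n (k' + 1) * lam j := by
        rw [sdProdP, Finset.prod_range_succ, ← sdProdP, show n - 1 - (k' + 1) = j by omega]
      rw [Finset.sum_range_succ, show n - (k' + 1) - 1 = j by omega, hPsucc]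
      have hcast : ((k' + 2 : ℕ) : ℝ) = ((k' + 1 + 2 - 1 : ℕ) : ℝ) := by norm_num
      nlinarith [ih', h37, hS0 n, hS0 j]
  have hfin := hind (n - 2) le_rfl
  rw [show n - 2 + 1 = n - 1 by omega, show n - (n - 2) - 1 = 1 by omega] at hfin
  -- `P(n-1) = ∏_{p=1}^{n-1} λ_p` (reverse the order of the factors)
  have hrefl : sdProdP lam n (n - 1) = ∏ i ∈ range (n - 1), lam (i + 1) := by
    rw [sdProdP, ← Finset.prod_range_reflect (fun i => lam (i + 1)) (n - 1)]
    refine Finset.prod_congr rfl fun i hi => ?_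
    have hi' := Finset.mem_range.mp hi
    rw [show n - 1 - 1 - i + 1 = n - 1 - i by omega]
  have hden : 0 < 1 + ∑ i ∈ range (n - 2), ((i + 2 : ℕ) : ℝ) * w (i + 2) * sdProdP lam n (i + 1) :=
    zero_lt_one.trans_le (one_le_sdAlphaP_den hlam hw hnN)
  rw [sdAlphaP, ← hrefl, div_mul_eq_mul_div, le_div_iff₀ hden]
  linarith [hfin]

/-- **(4.38) with perturbed rates, real-variable form**: from `S_n ≤ α_n(λ) S_1` for every bond and
`1 ≤ k ≤ N` one gets `∑_{k=1}^{N} k w_k S_k ≤ K(λ) S_1`. [cite: SalmhoferSeiler1991, (4.38)–(4.39)] -/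
theorem sum_le_sdKP_mul {N : ℕ} {w : ℕ → ℝ} (hw1 : 0 ≤ w 1) (hw : ∀ k, 2 ≤ k → k ≤ N → 0 ≤ w k)
    {lam : ℕ → ℝ} {S : ℕ → ℝ} (hS : ∀ k, 1 ≤ k → k ≤ N → S k ≤ sdAlphaP lam w k * S 1) :
    ∑ k ∈ range (N + 1), (k : ℝ) * w k * S k ≤ sdKP N lam w * S 1 := by
  rw [sdKP, Finset.sum_mul]
  refine Finset.sum_le_sum fun k hk => ?_
  have hkN : k ≤ N := Nat.lt_succ_iff.mp (Finset.mem_range.mp hk)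
  rcases Nat.eq_zero_or_pos k with rfl | hk1
  · simp
  have hwk : 0 ≤ w k := by
    rcases Nat.lt_or_ge k 2 with h | h
    · rw [show k = 1 by omega]; exact hw1
    · exact hw k h hkN
  rw [mul_assoc ((k : ℝ) * w k)]
  exact mul_le_mul_of_nonneg_left (hS k hk1 hkN) (mul_nonneg (Nat.cast_nonneg k) hwk)

/-! ### Continuity of `α_n(λ)` and `K(λ)` in the rates -/

section Continuity

variable {X : Type*} {l : Filter X} {lam : X → ℕ → ℝ} {lam₀ : ℕ → ℝ}

/-- `P_n(k)` depends continuously on the rates. [cite: SalmhoferSeiler1991, (4.36)] -/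
theorem tendsto_sdProdP (h : ∀ j, Tendsto (fun x => lam x j) l (𝓝 (lam₀ j))) (n k : ℕ) :
    Tendsto (fun x => sdProdP (lam x) n k) l (𝓝 (sdProdP lam₀ n k)) :=
  tendsto_finsetProd _ fun _ _ => h _

/-- **`α_n(λ)` depends continuously on the rates** (at rates where its denominator does not vanish, e.g.
nonnegative rates). [cite: SalmhoferSeiler1991, (4.29)] -/
theorem tendsto_sdAlphaP (h : ∀ j, Tendsto (fun x => lam x j) l (𝓝 (lam₀ j))) (w : ℕ → ℝ) (n : ℕ)
    (hden : 1 + ∑ i ∈ range (n - 2), ((i + 2 : ℕ) : ℝ) * w (i + 2) * sdProdP lam₀ n (i + 1) ≠ 0) :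
    Tendsto (fun x => sdAlphaP (lam x) w n) l (𝓝 (sdAlphaP lam₀ w n)) := by
  unfold sdAlphaP
  refine Tendsto.div (tendsto_finsetProd _ fun _ _ => h _) ?_ hden
  exact tendsto_const_nhds.add (tendsto_finsetSum _ fun i _ => (tendsto_sdProdP h n (i + 1)).const_mul _)

/-- **`K(λ)` depends continuously on the rates** (nonnegative limiting rates, `w_k ≥ 0` for `2 ≤ k ≤ N`). [cite: SalmhoferSeiler1991, (4.39)] -/
theorem tendsto_sdKP {N : ℕ} (h : ∀ j, Tendsto (fun x => lam x j) l (𝓝 (lam₀ j))) {w : ℕ → ℝ}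
    (hlam₀ : ∀ j, j ≤ N → 0 ≤ lam₀ j) (hw : ∀ k, 2 ≤ k → k ≤ N → 0 ≤ w k) :
    Tendsto (fun x => sdKP N (lam x) w) l (𝓝 (sdKP N lam₀ w)) := by
  unfold sdKP
  refine tendsto_finsetSum _ fun k hk => ?_
  have hkN : k ≤ N := Nat.lt_succ_iff.mp (Finset.mem_range.mp hk)
  exact (tendsto_sdAlphaP h w k (zero_lt_one.trans_le (one_le_sdAlphaP_den hlam₀ hw hkN)).ne').const_mul _

/-- The printed rates are nonnegative up to `N`: `1 - j/N ≥ 0` for `j ≤ N`. [cite: SalmhoferSeiler1991, (4.35)] -/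
theorem sdRate_nonneg {N j : ℕ} (hN : 1 ≤ N) (hj : j ≤ N) : 0 ≤ sdRate N j := by
  unfold sdRate
  rw [sub_nonneg, div_le_one (Nat.cast_pos.mpr hN)]
  exact_mod_cast hj

end Continuity

end ComplexSpin

end Literature.MathematicalPhysics.StatisticalMechanics
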